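import Mathlib.LinearAlgebra.Pi
import Mathlib.Logic.Equiv.Fin.Rotate
import Mathlib.Data.Real.Basic
import HarnessLib

/-!
# Stub N2 `stub_cyclicInvariant_eq_zero` for crux `MoebiusLimitExists`
(stmt-CriticalPhenomena-1344), line `Sketch` v20
(lead prover-line-stmt-CriticalPhenomena-1344-c20-0; THEOREM-ONLY, `--supports stmt-CriticalPhenomena-1344`)

**Averaging over a transitive group (pure linear algebra).**  A linear functional `ℓ` on `ℝⁿ = Fin n → ℝ`
that is invariant under the cyclic relabelling of coordinates `h ↦ h ∘ finRotate n` and vanishes on the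
constant vector `(1, …, 1)` vanishes identically.

Proof: for `n = 0` the domain is a singleton, so every `h` is the constant vector.  For `n = m + 1` put
`c i := ℓ eᵢ` with `eᵢ = fun j => if i = j then 1 else 0` the standard basis; since
`e_{i+1} ∘ finRotate (m+1) = eᵢ` (`finRotate_apply : finRotate (m+1) j = j + 1`), invariance gives
`c i = c (i + 1)`, hence `c i = c 0` for all `i` (`Fin.induction`).  Expanding in the basis
(`LinearMap.pi_apply_eq_sum_univ`), `0 = ℓ (1, …, 1) = ∑ i, c i = (m + 1) · c 0`, so `c 0 = 0`, all `c i = 0`,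
and `ℓ h = ∑ i, h i • c i = 0`.  Mathlib only; no definitions are introduced.
-/

namespace Summit.CriticalPhenomena.Ising3DConformalLimit.MoebiusLimitExistsSketchV20

/-- **Stub N2 — a cyclically invariant linear functional on `ℝⁿ` killing `(1, …, 1)` is zero.**  If
`ℓ : (Fin n → ℝ) →ₗ[ℝ] ℝ` satisfies `ℓ (h ∘ finRotate n) = ℓ h` for all `h` and `ℓ (fun _ => 1) = 0`, then
`ℓ = 0`: its values `c i` on the standard basis vectors satisfy `c i = c (i + 1)` by invariance, so they are
all equal to `c 0`, and their sum `(n : ℝ) * c 0` is `ℓ (1, …, 1) = 0`; hence every `c i` vanishes and so does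
`ℓ h = ∑ i, h i • c i` (for `n = 0` the domain is a singleton). [folklore] -/
theorem stub_cyclicInvariant_eq_zero : ∀ (n : ℕ) (ℓ : (Fin n → ℝ) →ₗ[ℝ] ℝ),
    (∀ h : Fin n → ℝ, ℓ (h ∘ finRotate n) = ℓ h) → ℓ (fun _ => 1) = 0 → ∀ h : Fin n → ℝ, ℓ h = 0 := by
  intro n ℓ hrot hone h
  cases n with
  | zero =>
    rw [Subsingleton.elim h fun _ => 1]
    exact hone
  | succ m =>
    -- values of `ℓ` on the standard basis
    obtain ⟨c, hc⟩ : ∃ c : Fin (m + 1) → ℝ, ∀ i, ℓ (fun j => if i = j then (1:ℝ) else 0) = c i :=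
      ⟨_, fun _ => rfl⟩
    -- invariance under the cyclic shift: `c i = c (i + 1)`
    have hstep : ∀ i, c i = c (i + 1) := by
      intro i
      have hfun : ((fun j => if i + 1 = j then (1:ℝ) else 0) ∘ ⇑(finRotate (m + 1))) =
          fun j => if i = j then (1:ℝ) else 0 := by
        funext j
        simp only [Function.comp_apply, finRotate_apply, add_left_inj]
      have := hrot fun j => if i + 1 = j then (1:ℝ) else 0
      rwa [hfun, hc, hc] at this
    -- transitivity: every index is reached from `0`
    have hall : ∀ i, c i = c 0 := by
      intro i
      induction i using Fin.induction with
      | zero => rfl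
      | succ k ih => rw [← Fin.coeSucc_eq_succ, ← hstep, ih]
    -- the free zero `ℓ (1, …, 1) = 0` reads `(m + 1) * c 0 = 0`
    have hsum : ((m + 1 : ℕ) : ℝ) * c 0 = 0 := by
      calc ((m + 1 : ℕ) : ℝ) * c 0 = ∑ i : Fin (m + 1), c i := by
            rw [Finset.sum_congr rfl fun i _ => hall i, Finset.sum_const, Finset.card_univ,
              Fintype.card_fin, nsmul_eq_mul]
        _ = ℓ fun _ => 1 := by
            rw [LinearMap.pi_apply_eq_sum_univ]
            exact Finset.sum_congr rfl fun i _ => by simp only [one_smul, hc]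
        _ = 0 := hone
    have hc0 : c 0 = 0 := (mul_eq_zero.mp hsum).resolve_left (Nat.cast_ne_zero.mpr (Nat.succ_ne_zero m))
    -- conclusion: expand `h` in the standard basis
    rw [LinearMap.pi_apply_eq_sum_univ]
    exact Finset.sum_eq_zero fun i _ => by rw [hc, hall, hc0, smul_zero]

end Summit.CriticalPhenomena.Ising3DConformalLimit.MoebiusLimitExistsSketchV20
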